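import Mathlib
import HarnessLib
import Literature.MathematicalPhysics.KineticTheory.HardSphereEuler
import Literature.MathematicalPhysics.KineticTheory.BackwardCluster
import Literature.MathematicalPhysics.KineticTheory.GoodConfigurations
import Literature.MathematicalPhysics.KineticTheory.HardSphereDisplacementPathLength

/-!
# Slab proximity of contact partners — the deterministic input of the stub `stub_linkCountTail`
of the line `Sketch` for the crux `RelayRaceLocality.GibbsLightCone` (stmt-AtomisticToContinuum-12501)

Helper file (`--supports stmt-AtomisticToContinuum-12501`) for the registered stub
`stub_linkCountTail` (LINK-COUNT TAIL: under the invariant Gibbs law, some SIMPLE collision chain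
into the tagged particle over a window of `M` mean-free-time units has more than `λ M / σ³` links
with probability `≤ C e^{-cM}`). Every proposed proof of that tail transports a run of consecutive
links of the chain, all happening inside a short time slab `[a, b]`, to ONE time slice `s ∈ [a, b]`
of the slab, where the run becomes a "necklace" — a simple path of the static near-contact graph of
the configuration at time `s`, whose law is the (single-time, invariant) Gibbs law. The transport is
the deterministic kinematics proved here, on one good orbit of a hard-sphere flow on the flat torus
`T^d` (GST 2013 §4.1: good orbits are piecewise free flight with continuous positions):

* the minimal-image distance of two particles changes, between two times, by at most the sum of
  their two path lengths (`pairDist_le_pairDist_add_abs_pathLength`, window form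
  `pairDist_le_pairDist_add_pathLength_of_mem_Icc`) — displacement of one particle is at most its
  path length (`HardSphereFlow.euclidDist_flow_le_integral_norm_vel`, tree) and the triangle
  inequality (`torus_euclidDist_triangle`);
* contact partners (`s(i, j) ∈ contactPairSet`, distance exactly `ε`) at some time of the slab are,
  at every time of the slab, within `ε +` (their two path lengths over the slab)
  (`pairDist_le_diam_add_pathLength_of_contact`);
* **slab proximity**: if moreover both have speed `≤ K` on the slab, they are within
  `ε + 2 K (b - a)` at every time of the slab (`slabProximity_of_contact`; the two one-sided forms
  `slabProximity_of_contact_right` — contact at the END of the slab, proximity at its START, the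
  form quoted in the stub brief — and `slabProximity_of_contact_left`);
* chain form: a collision chain all of whose links happen in the slab and all of whose carriers
  have speed `≤ K` on the slab is, at every single time of the slab, a necklace of hops
  `≤ ε + 2 K (b - a)` (`chain_slabProximity`; path-length form `chain_pairDist_le_of_links_mem_Icc`).

Theorems only (no definitions); general torus dimension `d` (the stub is `d = Fin 3`).

Reference: I. Gallagher, L. Saint-Raymond, B. Texier, *From Newton to Boltzmann* (2013), §4.1.
-/

namespace Summit.AtomisticToContinuum.HydrodynamicLimit.Theorems.LogWindowTaggedTail

open Literature.MathematicalPhysics.KineticTheory Literature.Analysis.FluidPDE MeasureTheory Filter Set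

open scoped ENNReal

variable {d : Type*} [Fintype d] {ε : ℝ} {N : ℕ}

/-! ## Contact = minimal-image distance exactly `ε` -/

/-- Two particles whose unordered pair belongs to the event of a configuration on `T^d` are distinct
and at minimal-image distance exactly `ε`. [folklore] -/
theorem ne_and_euclidDist_eq_of_mem_contactPairSet {w : Config N d (UnitAddTorus d)} {j l : Fin N}
    (h : s(j, l) ∈ contactPairSet (Torus.geometry d) ε w) :
    j ≠ l ∧ Torus.euclidDist (w j).1 (w l).1 = ε := by
  obtain ⟨hne, hc | hc⟩ := mem_contactPairSet.1 h
  · exact ⟨hne, (mem_contactSet.1 hc).2⟩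
  · refine ⟨hne, ?_⟩
    rw [Torus.euclidDist_comm]
    exact (mem_contactSet.1 hc).2

/-- Two particles whose unordered pair belongs to the event of a configuration on `T^d` are at
minimal-image distance exactly `ε`. [folklore] -/
theorem euclidDist_eq_of_mem_contactPairSet {w : Config N d (UnitAddTorus d)} {j l : Fin N}
    (h : s(j, l) ∈ contactPairSet (Torus.geometry d) ε w) :
    Torus.euclidDist (w j).1 (w l).1 = ε :=
  (ne_and_euclidDist_eq_of_mem_contactPairSet h).2

/-! ## The pair distance moves by at most the two path lengths -/

/-- **Pair distance vs. path lengths** (order-free form): on a good orbit, the minimal-image distance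
between particles `i` and `j` at time `t` exceeds their distance at time `t'` by at most
`|∫_{t'}^{t} ‖v_i‖| + |∫_{t'}^{t} ‖v_j‖|` (each particle moves by at most its path length,
`HardSphereFlow.euclidDist_flow_le_abs_integral_norm_vel`; triangle inequality twice). [folklore] -/
theorem pairDist_le_pairDist_add_abs_pathLength (Φ : HardSphereFlow (Torus.geometry d) ε N)
    {z : Config N d (UnitAddTorus d)} (hz : z ∈ Φ.good) (i j : Fin N) (t t' : ℝ) :
    Torus.euclidDist (Φ.flow t z i).1 (Φ.flow t z j).1 ≤
      Torus.euclidDist (Φ.flow t' z i).1 (Φ.flow t' z j).1 +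
        |∫ u in t'..t, ‖(Φ.flow u z i).2‖| + |∫ u in t'..t, ‖(Φ.flow u z j).2‖| := by
  have h1 := Φ.euclidDist_flow_le_abs_integral_norm_vel hz i t t'
  have h2 := Φ.euclidDist_flow_le_abs_integral_norm_vel hz j t' t
  rw [intervalIntegral.integral_symm, abs_neg] at h2
  have htri₁ := torus_euclidDist_triangle (Φ.flow t z i).1 (Φ.flow t' z i).1 (Φ.flow t z j).1
  have htri₂ := torus_euclidDist_triangle (Φ.flow t' z i).1 (Φ.flow t' z j).1 (Φ.flow t z j).1
  linarith

/-- **Pair distance vs. path lengths, window form**: for two times `s, s'` of a window `[a, b]`, the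
distance between `i` and `j` at time `s` exceeds their distance at time `s'` by at most the two path
lengths over the whole window, `∫_a^b ‖v_i‖ + ∫_a^b ‖v_j‖`. [folklore] -/
theorem pairDist_le_pairDist_add_pathLength_of_mem_Icc (Φ : HardSphereFlow (Torus.geometry d) ε N)
    {z : Config N d (UnitAddTorus d)} (hz : z ∈ Φ.good) (i j : Fin N) {a b s s' : ℝ}
    (hs : s ∈ Icc a b) (hs' : s' ∈ Icc a b) :
    Torus.euclidDist (Φ.flow s z i).1 (Φ.flow s z j).1 ≤
      Torus.euclidDist (Φ.flow s' z i).1 (Φ.flow s' z j).1 +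
        (∫ u in a..b, ‖(Φ.flow u z i).2‖) + ∫ u in a..b, ‖(Φ.flow u z j).2‖ := by
  have h1 := Φ.euclidDist_flow_le_integral_norm_vel_of_mem_Icc₂ hz i hs hs'
  have h2 := Φ.euclidDist_flow_le_integral_norm_vel_of_mem_Icc₂ hz j hs' hs
  have htri₁ := torus_euclidDist_triangle (Φ.flow s z i).1 (Φ.flow s' z i).1 (Φ.flow s z j).1
  have htri₂ := torus_euclidDist_triangle (Φ.flow s' z i).1 (Φ.flow s' z j).1 (Φ.flow s z j).1
  linarith

/-! ## Contact partners stay close: path-length forms -/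

/-- **Contact partners, order-free form**: if `{i, j}` are in contact at time `t'` then at any time
`t` they are within `ε + |∫_{t'}^{t} ‖v_i‖| + |∫_{t'}^{t} ‖v_j‖|`. [folklore] -/
theorem pairDist_le_diam_add_abs_pathLength_of_contact (Φ : HardSphereFlow (Torus.geometry d) ε N)
    {z : Config N d (UnitAddTorus d)} (hz : z ∈ Φ.good) {i j : Fin N} {t' : ℝ}
    (hc : s(i, j) ∈ contactPairSet (Torus.geometry d) ε (Φ.flow t' z)) (t : ℝ) :
    Torus.euclidDist (Φ.flow t z i).1 (Φ.flow t z j).1 ≤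
      ε + |∫ u in t'..t, ‖(Φ.flow u z i).2‖| + |∫ u in t'..t, ‖(Φ.flow u z j).2‖| := by
  have h := pairDist_le_pairDist_add_abs_pathLength Φ hz i j t t'
  rwa [euclidDist_eq_of_mem_contactPairSet hc] at h

/-- **Contact partners, looking back** (`t ≤ t'`): if `{i, j}` are in contact at the later time `t'`
then at the earlier time `t` they are within `ε + ∫_t^{t'} ‖v_i‖ + ∫_t^{t'} ‖v_j‖`. [folklore] -/
theorem pairDist_le_diam_add_pathLength_of_contact_later (Φ : HardSphereFlow (Torus.geometry d) ε N)
    {z : Config N d (UnitAddTorus d)} (hz : z ∈ Φ.good) {i j : Fin N} {t t' : ℝ} (htt' : t ≤ t')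
    (hc : s(i, j) ∈ contactPairSet (Torus.geometry d) ε (Φ.flow t' z)) :
    Torus.euclidDist (Φ.flow t z i).1 (Φ.flow t z j).1 ≤
      ε + (∫ u in t..t', ‖(Φ.flow u z i).2‖) + ∫ u in t..t', ‖(Φ.flow u z j).2‖ := by
  have h := pairDist_le_diam_add_abs_pathLength_of_contact Φ hz hc t
  rwa [intervalIntegral.integral_symm t, intervalIntegral.integral_symm t, abs_neg, abs_neg,
    abs_of_nonneg (Φ.integral_norm_vel_flow_nonneg z i htt'),
    abs_of_nonneg (Φ.integral_norm_vel_flow_nonneg z j htt')] at h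

/-- **Contact partners, looking forward** (`t' ≤ t`): if `{i, j}` are in contact at the earlier time
`t'` then at the later time `t` they are within `ε + ∫_{t'}^{t} ‖v_i‖ + ∫_{t'}^{t} ‖v_j‖`.
[folklore] -/
theorem pairDist_le_diam_add_pathLength_of_contact_earlier
    (Φ : HardSphereFlow (Torus.geometry d) ε N) {z : Config N d (UnitAddTorus d)} (hz : z ∈ Φ.good)
    {i j : Fin N} {t t' : ℝ} (ht't : t' ≤ t)
    (hc : s(i, j) ∈ contactPairSet (Torus.geometry d) ε (Φ.flow t' z)) :
    Torus.euclidDist (Φ.flow t z i).1 (Φ.flow t z j).1 ≤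
      ε + (∫ u in t'..t, ‖(Φ.flow u z i).2‖) + ∫ u in t'..t, ‖(Φ.flow u z j).2‖ := by
  have h := pairDist_le_diam_add_abs_pathLength_of_contact Φ hz hc t
  rwa [abs_of_nonneg (Φ.integral_norm_vel_flow_nonneg z i ht't),
    abs_of_nonneg (Φ.integral_norm_vel_flow_nonneg z j ht't)] at h

/-- **Contact partners, window form**: if `{i, j}` are in contact at some time `s'` of a window
`[a, b]`, then at every time `s` of the window they are within `ε + ∫_a^b ‖v_i‖ + ∫_a^b ‖v_j‖`.
[folklore] -/
theorem pairDist_le_diam_add_pathLength_of_contact (Φ : HardSphereFlow (Torus.geometry d) ε N)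
    {z : Config N d (UnitAddTorus d)} (hz : z ∈ Φ.good) {i j : Fin N} {a b s s' : ℝ}
    (hs : s ∈ Icc a b) (hs' : s' ∈ Icc a b)
    (hc : s(i, j) ∈ contactPairSet (Torus.geometry d) ε (Φ.flow s' z)) :
    Torus.euclidDist (Φ.flow s z i).1 (Φ.flow s z j).1 ≤
      ε + (∫ u in a..b, ‖(Φ.flow u z i).2‖) + ∫ u in a..b, ‖(Φ.flow u z j).2‖ := by
  have h := pairDist_le_pairDist_add_pathLength_of_mem_Icc Φ hz i j hs hs'
  rwa [euclidDist_eq_of_mem_contactPairSet hc] at h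

/-! ## Speed threshold on a slab: path length `≤ K ×` duration -/

/-- On a good orbit, a particle whose speed is at most `K` throughout `[a, b]` (`a ≤ b`) has path
length at most `K (b - a)` there (`intervalIntegral.integral_mono_on`; the speed is interval
integrable, `HardSphereFlow.intervalIntegrable_norm_vel_flow`). [folklore] -/
theorem pathLength_le_of_speed_le (Φ : HardSphereFlow (Torus.geometry d) ε N)
    {z : Config N d (UnitAddTorus d)} (hz : z ∈ Φ.good) (i : Fin N) {K a b : ℝ} (hab : a ≤ b)
    (hK : ∀ u ∈ Icc a b, ‖(Φ.flow u z i).2‖ ≤ K) :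
    ∫ u in a..b, ‖(Φ.flow u z i).2‖ ≤ K * (b - a) := by
  have h := intervalIntegral.integral_mono_on hab (Φ.intervalIntegrable_norm_vel_flow hz i a b)
    intervalIntegrable_const hK
  rwa [intervalIntegral.integral_const, smul_eq_mul, mul_comm] at h

/-! ## Slab proximity -/

/-- **SLAB PROXIMITY** (the deterministic input of `stub_linkCountTail`): on a good orbit, if
particles `i`, `j` both have speed `≤ K` on the time slab `[a, b]` and are in contact at some time
`s'` of the slab, then at EVERY time `s` of the slab they are within `ε + 2 K (b - a)` — so a run of
links inside one slab is, at any single time of the slab, a path of the near-contact graph of radius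
`ε + 2 K (b - a)`. [folklore] -/
theorem slabProximity_of_contact (Φ : HardSphereFlow (Torus.geometry d) ε N)
    {z : Config N d (UnitAddTorus d)} (hz : z ∈ Φ.good) {i j : Fin N} {K a b s s' : ℝ}
    (hs : s ∈ Icc a b) (hs' : s' ∈ Icc a b)
    (hKi : ∀ u ∈ Icc a b, ‖(Φ.flow u z i).2‖ ≤ K) (hKj : ∀ u ∈ Icc a b, ‖(Φ.flow u z j).2‖ ≤ K)
    (hc : s(i, j) ∈ contactPairSet (Torus.geometry d) ε (Φ.flow s' z)) :
    Torus.euclidDist (Φ.flow s z i).1 (Φ.flow s z j).1 ≤ ε + 2 * K * (b - a) := by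
  have hab : a ≤ b := hs.1.trans hs.2
  have h := pairDist_le_diam_add_pathLength_of_contact Φ hz hs hs' hc
  have hi := pathLength_le_of_speed_le Φ hz i hab hKi
  have hj := pathLength_le_of_speed_le Φ hz j hab hKj
  linarith

/-- **Slab proximity, contact at the end of the slab** (the form quoted in the stub brief): on a good
orbit, if `i`, `j` both have speed `≤ K` on `[u₁, u₂]` (`u₁ ≤ u₂`) and are in contact at time `u₂`,
then at time `u₁` they are within `ε + 2 K (u₂ - u₁)`. [folklore] -/
theorem slabProximity_of_contact_right (Φ : HardSphereFlow (Torus.geometry d) ε N)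
    {z : Config N d (UnitAddTorus d)} (hz : z ∈ Φ.good) {i j : Fin N} {K u₁ u₂ : ℝ} (h12 : u₁ ≤ u₂)
    (hKi : ∀ u ∈ Icc u₁ u₂, ‖(Φ.flow u z i).2‖ ≤ K)
    (hKj : ∀ u ∈ Icc u₁ u₂, ‖(Φ.flow u z j).2‖ ≤ K)
    (hc : s(i, j) ∈ contactPairSet (Torus.geometry d) ε (Φ.flow u₂ z)) :
    Torus.euclidDist (Φ.flow u₁ z i).1 (Φ.flow u₁ z j).1 ≤ ε + 2 * K * (u₂ - u₁) :=
  slabProximity_of_contact Φ hz (left_mem_Icc.2 h12) (right_mem_Icc.2 h12) hKi hKj hc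

/-- **SLAB PROXIMITY on `𝕋³`** (registered helper stub of the line `Sketch`, the deterministic
input of `stub_linkCountTail`; the `d = Fin 3`, binder-free form of
`slabProximity_of_contact_right`): on a good orbit of a hard-sphere flow of `N` spheres of
diameter `ε` on `𝕋³`, if particles `i`, `j` both have speed `≤ K` on `[u₁, u₂]` (`u₁ ≤ u₂`) and
are in contact at time `u₂`, then at time `u₁` they are within `ε + 2 K (u₂ - u₁)`. [folklore] -/
theorem stub_slabProximity :
    ∀ (N : ℕ) (ε : ℝ) (Φ : HardSphereFlow (Torus.geometry (Fin 3)) ε N) (z : Config N (Fin 3) T3),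
      z ∈ Φ.good → ∀ (i j : Fin N) (K u₁ u₂ : ℝ), u₁ ≤ u₂ →
        (∀ u ∈ Set.Icc u₁ u₂, ‖((Φ.flow u z) i).2‖ ≤ K) →
        (∀ u ∈ Set.Icc u₁ u₂, ‖((Φ.flow u z) j).2‖ ≤ K) →
        s(i, j) ∈ contactPairSet (Torus.geometry (Fin 3)) ε (Φ.flow u₂ z) →
        Torus.euclidDist ((Φ.flow u₁ z) i).1 ((Φ.flow u₁ z) j).1 ≤ ε + 2 * K * (u₂ - u₁) :=
  fun _ _ Φ _ hz _ _ _ _ _ h12 hKi hKj hc => slabProximity_of_contact_right Φ hz h12 hKi hKj hc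

/-- **Slab proximity, contact at the start of the slab**: on a good orbit, if `i`, `j` both have
speed `≤ K` on `[u₁, u₂]` (`u₁ ≤ u₂`) and are in contact at time `u₁`, then at time `u₂` they are
within `ε + 2 K (u₂ - u₁)`. [folklore] -/
theorem slabProximity_of_contact_left (Φ : HardSphereFlow (Torus.geometry d) ε N)
    {z : Config N d (UnitAddTorus d)} (hz : z ∈ Φ.good) {i j : Fin N} {K u₁ u₂ : ℝ} (h12 : u₁ ≤ u₂)
    (hKi : ∀ u ∈ Icc u₁ u₂, ‖(Φ.flow u z i).2‖ ≤ K)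
    (hKj : ∀ u ∈ Icc u₁ u₂, ‖(Φ.flow u z j).2‖ ≤ K)
    (hc : s(i, j) ∈ contactPairSet (Torus.geometry d) ε (Φ.flow u₁ z)) :
    Torus.euclidDist (Φ.flow u₂ z i).1 (Φ.flow u₂ z j).1 ≤ ε + 2 * K * (u₂ - u₁) :=
  slabProximity_of_contact Φ hz (right_mem_Icc.2 h12) (left_mem_Icc.2 h12) hKi hKj hc

/-- Slab proximity from a bound on the two PATH LENGTHS over the slab (rather than on the speeds):
contact at `s' ∈ [a, b]` and `∫_a^b ‖v_i‖, ∫_a^b ‖v_j‖ ≤ L` give distance `≤ ε + 2 L` at every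
`s ∈ [a, b]` (the form fed by a hot/cold split of the path length). [folklore] -/
theorem slabProximity_of_contact_of_pathLength_le (Φ : HardSphereFlow (Torus.geometry d) ε N)
    {z : Config N d (UnitAddTorus d)} (hz : z ∈ Φ.good) {i j : Fin N} {L a b s s' : ℝ}
    (hs : s ∈ Icc a b) (hs' : s' ∈ Icc a b)
    (hLi : ∫ u in a..b, ‖(Φ.flow u z i).2‖ ≤ L) (hLj : ∫ u in a..b, ‖(Φ.flow u z j).2‖ ≤ L)
    (hc : s(i, j) ∈ contactPairSet (Torus.geometry d) ε (Φ.flow s' z)) :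
    Torus.euclidDist (Φ.flow s z i).1 (Φ.flow s z j).1 ≤ ε + 2 * L := by
  have h := pairDist_le_diam_add_pathLength_of_contact Φ hz hs hs' hc
  linarith

/-! ## Chains inside one slab are necklaces at every single time of the slab -/

/-- **Chain in a slab, path-length form**: along a collision chain `q 0, …, q k` whose link `m`
(contact of `{q m, q (m+1)}`) happens at a time `τ m` of the slab `[a, b]`, at every single time `s`
of the slab consecutive carriers are within `ε +` (their two path lengths over the slab). [folklore] -/
theorem chain_pairDist_le_of_links_mem_Icc (Φ : HardSphereFlow (Torus.geometry d) ε N)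
    {z : Config N d (UnitAddTorus d)} (hz : z ∈ Φ.good) {k : ℕ} (q : Fin (k + 1) → Fin N)
    (τ : Fin k → ℝ) {a b : ℝ} (hτ : ∀ m, τ m ∈ Icc a b)
    (hlink : ∀ m : Fin k, s(q (Fin.castSucc m), q (Fin.succ m)) ∈
      contactPairSet (Torus.geometry d) ε (Φ.flow (τ m) z))
    {s : ℝ} (hs : s ∈ Icc a b) (m : Fin k) :
    Torus.euclidDist (Φ.flow s z (q (Fin.castSucc m))).1 (Φ.flow s z (q (Fin.succ m))).1 ≤
      ε + (∫ u in a..b, ‖(Φ.flow u z (q (Fin.castSucc m))).2‖) +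
        ∫ u in a..b, ‖(Φ.flow u z (q (Fin.succ m))).2‖ :=
  pairDist_le_diam_add_pathLength_of_contact Φ hz hs (hτ m) (hlink m)

/-- **CHAIN SLAB PROXIMITY**: along a collision chain `q 0, …, q k` all of whose links happen in the
slab `[a, b]` and all of whose carriers have speed `≤ K` on the slab, at every single time `s` of
the slab consecutive carriers are within `ε + 2 K (b - a)`: the chain is a path (simple if `q` is
injective) of the near-contact graph of radius `ε + 2 K (b - a)` of the time-`s` configuration.
[folklore] -/
theorem chain_slabProximity (Φ : HardSphereFlow (Torus.geometry d) ε N)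
    {z : Config N d (UnitAddTorus d)} (hz : z ∈ Φ.good) {k : ℕ} (q : Fin (k + 1) → Fin N)
    (τ : Fin k → ℝ) {K a b : ℝ} (hτ : ∀ m, τ m ∈ Icc a b)
    (hK : ∀ l : Fin (k + 1), ∀ u ∈ Icc a b, ‖(Φ.flow u z (q l)).2‖ ≤ K)
    (hlink : ∀ m : Fin k, s(q (Fin.castSucc m), q (Fin.succ m)) ∈
      contactPairSet (Torus.geometry d) ε (Φ.flow (τ m) z))
    {s : ℝ} (hs : s ∈ Icc a b) (m : Fin k) :
    Torus.euclidDist (Φ.flow s z (q (Fin.castSucc m))).1 (Φ.flow s z (q (Fin.succ m))).1 ≤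
      ε + 2 * K * (b - a) :=
  slabProximity_of_contact Φ hz hs (hτ m) (hK _) (hK _) (hlink m)

/-- **Chain slab proximity in the stub's indexing** (hand-over times `T : Fin (k + 2) → ℝ`, link `m`
at time `T (m+1)`, as in `stub_linkCountTail`): if the links `m` with `T (m+1) ∈ [a, b]` are
considered and the two carriers of such a link have speed `≤ K` on `[a, b]`, then at every time
`s ∈ [a, b]` these two carriers are within `ε + 2 K (b - a)`. [folklore] -/
theorem chain_slabProximity' (Φ : HardSphereFlow (Torus.geometry d) ε N)
    {z : Config N d (UnitAddTorus d)} (hz : z ∈ Φ.good) {k : ℕ} (q : Fin (k + 1) → Fin N)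
    (T : Fin (k + 2) → ℝ) {K a b : ℝ}
    (hlink : ∀ m : Fin k, s(q (Fin.castSucc m), q (Fin.succ m)) ∈
      contactPairSet (Torus.geometry d) ε (Φ.flow (T (Fin.castSucc (Fin.succ m))) z))
    (m : Fin k) (hm : T (Fin.castSucc (Fin.succ m)) ∈ Icc a b)
    (hK₁ : ∀ u ∈ Icc a b, ‖(Φ.flow u z (q (Fin.castSucc m))).2‖ ≤ K)
    (hK₂ : ∀ u ∈ Icc a b, ‖(Φ.flow u z (q (Fin.succ m))).2‖ ≤ K)
    {s : ℝ} (hs : s ∈ Icc a b) :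
    Torus.euclidDist (Φ.flow s z (q (Fin.castSucc m))).1 (Φ.flow s z (q (Fin.succ m))).1 ≤
      ε + 2 * K * (b - a) :=
  slabProximity_of_contact Φ hz hs hm hK₁ hK₂ (hlink m)

end Summit.AtomisticToContinuum.HydrodynamicLimit.Theorems.LogWindowTaggedTail
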